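import Literature.NumberTheory.Automorphic.ArchEndoscopicChartExhaustion        -- ★ (EXH-H) (+ (CENT-H∕G), atlases PART 1∕1b∕2a–2d, (COORD), `archPiEquivCM`, `coe_archPiEquivCM_apply`)
import Literature.LinearAlgebra.Matrix.UnitaryGroupConjugacyClasses             -- ★ `exists_perm_of_charpoly_diagonal_eq`
import HarnessLib

/-!
# Norm pairs between the Cartan atlases: `endoTorus S c ↔ gprimeTorus α S′ c′` place by place ((PARTNER) P1; Rogawski 1990 §3.1, §4.3, §14.1–14.3)

Topic `NumberTheory/Automorphic`; namespace `Literature.NumberTheory.Automorphic.UnitaryGroup`.  THEOREMS ONLY (no `def`, no instance, no notation, no axiom, no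
named fact, no `sorry`).  Cell `pub/hodgecm-mathlib`, crux H413 (`stmt-HodgeConjecture-24833`), F0∕P3c line LH3, DIRECT ROAD of `stub_N9`; seat LH3-p03 (g2); organ
(PARTNER) of LH3-plan (g2) (05:43:32Z ∕ 05:49:35Z), part P1 of the cut 06:3xZ: the NORM-PAIR CRITERION between chart points and the PARTNER FAMILY.  Count-neutral.

THE MATHEMATICS.  `IsArchNormPair L H′ γ_H γ′` is `ι_∞(γ_H) ∼ γ′` in `GL₃(L ⊗ ℝ)` (★ `isArchNormPair_iff`: `Corresponds` = `IsConj` of the two `GL₃(L ⊗ ℝ)`-elements), and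
conjugacy in `GL₃(L ⊗ ℝ) = ∏_w GL₃(ℂ)` is checked place by place (★ `GLnMixedPiEquiv`; `isConj_iff_forall_place`).  At a place `w` both chart points are EXPLICITLY
`GL₃(ℂ)`-conjugate to diagonal matrices: `ι(endoTorus S c)_w = E·diag(e^{ic₀}, e^{ic₁}, e^{ic₂})·E⁻¹` (`E = ι(P, 1)`, Cayley frame) at `w ∉ S` and `= diag(e^{x+iθ}, e^{iφ},
e^{−x+iθ})` at `w ∈ S` (★ `coe_endoGL_eq`, ★ `endoGL_circleDiagonal`); `(gprimeTorus α S′ c′)_w = diag(e^{ic′_{τ⁻¹ℓ}})_ℓ` at `w ∉ S′` and `= K·diag(boostEig c′ ∘ τ⁻¹)·K⁻¹`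
(`K` = the re-indexed eigenvector matrix `cayB`, ★ `boostStd_eq_conj_diagonal`) at `w ∈ S′ ⊆ splitChartPlaces`.  Two matrices conjugate to diagonals `diag(d)`, `diag(d′)`
are conjugate iff `d′ = d ∘ σ` for a permutation `σ` (characteristic polynomials, ★ `exists_perm_of_charpoly_diagonal_eq`; permutation matrices for the converse) —
`isConj_iff_exists_perm_of_eq_conj_diagonal`.  Hence **`endoTorus S c ↔ gprimeTorus α S′ c′` iff at every place the `G′` eigenvalue triple is a permutation of the
`H` triple** (`isArchNormPair_endoTorus_gprimeTorus_iff`), and in particular the PARTNER FAMILY: for the same chart set `S ⊆ splitChartPlaces` and any slot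
permutations `ρ_w` trivial on `S`, **`endoTorus S c ↔ gprimeTorus α S (c_w ∘ ρ_w)_w`** (`isArchNormPair_endoTorus_gprimeTorus_perm`) — at a split place the coordinates
agree identically (`boostEig (x, φ, θ) = (e^{x+iθ}, e^{iφ}, e^{−x+iθ})` IS the `H` triple).  The class-level statements (every norm-partner class is a chart class;
which `ρ` give the same class; the count `N`) are parts P2 (EXH-G′) and P3 of the cut.
* §1 generic: `isConj_units_iff_coe`, `isConj_diagonal_perm`, `isConj_iff_exists_perm_of_eq_conj_diagonal`, `isConj_iff_forall_place`;
* §2 place presentations: `coe_endoGL_cayley_eq_conj_diagonal`, `coe_endoGL_hypBlockGL_eq_diagonal`, `coe_gprimeSplitGL_eq_conj_diagonal`;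
* §3 **`isArchNormPair_endoTorus_gprimeTorus_iff`**, **`isArchNormPair_endoTorus_gprimeTorus_perm`**.
HONEST LABEL: HC_CM is proved only modulo the 7 printed citations (2 remaining: hLiu418 = `stmt-HodgeConjecture-24832`, h413 = `stmt-HodgeConjecture-24833`) until rung 0
closes; chart bookkeeping, count-neutral (+0∕+0).

## References
* [Rogawski1990] J. D. Rogawski, *Automorphic Representations of Unitary Groups in Three Variables*, Ann. of Math. Stud. 123 (1990), §3.1 p. 19 (stable conjugacy =
  conjugacy in `GL_n`), §4.3 p. 42 (`γ_H → γ`: same eigenvalues), §14.1 p. 232, §14.3 p. 234 (the archimedean norm map).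
* [BrockerTomDieck1985] T. Bröcker, T. tom Dieck, *Representations of Compact Lie Groups* (1985), IV (2.5) (diagonal matrices with the same eigenvalues differ by a
  permutation).
-/

set_option autoImplicit false

noncomputable section

open NumberField NumberField.InfinitePlace NumberField.mixedEmbedding Matrix Complex
open scoped MatrixGroups Matrix ComplexConjugate Real Classical

namespace Literature.NumberTheory.Automorphic.UnitaryGroup

open Literature.NumberTheory.Rogawski1990

/-! ## §1 Generic: conjugacy of matrices presented as conjugates of diagonals; conjugacy place by place -/

section Generic

variable {n : Type*} [Fintype n] [DecidableEq n]

/-- Units are conjugate in the unit group iff they are conjugate in the monoid. [folklore] [cite: Rogawski1990, §3.1 p. 19] -/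
theorem isConj_units_iff_coe {M : Type*} [Monoid M] (a b : Mˣ) : IsConj a b ↔ IsConj (a : M) (b : M) := by
  constructor
  · exact fun h => (Units.coeHom M).map_isConj h
  · rintro ⟨c, hc⟩
    refine isConj_iff.2 ⟨c, Units.ext ?_⟩
    have hc' : (c : M) * a = b * c := hc
    rw [Units.val_mul, Units.val_mul, hc', mul_assoc, Units.mul_inv, mul_one]

/-- **`diag(d) ∼ diag(d ∘ σ)`** in `M_n(ℂ)` (conjugate by the permutation matrix of `σ`). [cite: BrockerTomDieck1985, IV (2.5) (p0156)] -/
theorem isConj_diagonal_perm (d : n → ℂ) (σ : Equiv.Perm n) : IsConj (Matrix.diagonal d) (Matrix.diagonal fun i => d (σ i)) := by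
  have h1 : (σ.toPEquiv.toMatrix : Matrix n n ℂ) * σ.symm.toPEquiv.toMatrix = 1 := by
    rw [← PEquiv.toMatrix_trans, ← Equiv.toPEquiv_trans, Equiv.self_trans_symm, Equiv.toPEquiv_refl, PEquiv.toMatrix_refl]
  have h2 : (σ.symm.toPEquiv.toMatrix : Matrix n n ℂ) * σ.toPEquiv.toMatrix = 1 := by
    rw [← PEquiv.toMatrix_trans, ← Equiv.toPEquiv_trans, Equiv.symm_trans_self, Equiv.toPEquiv_refl, PEquiv.toMatrix_refl]
  refine ⟨⟨σ.toPEquiv.toMatrix, σ.symm.toPEquiv.toMatrix, h1, h2⟩, ?_⟩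
  show (σ.toPEquiv.toMatrix : Matrix n n ℂ) * Matrix.diagonal d = (Matrix.diagonal fun i => d (σ i)) * σ.toPEquiv.toMatrix
  rw [PEquiv.toMatrix_toPEquiv_mul, PEquiv.mul_toMatrix_toPEquiv]
  ext i j
  simp only [Matrix.submatrix_apply, id, Matrix.diagonal_apply]
  by_cases h : σ i = j
  · rw [if_pos h, if_pos ((Equiv.apply_eq_iff_eq_symm_apply σ).1 h)]
  · rw [if_neg h, if_neg (fun h' => h ((Equiv.apply_eq_iff_eq_symm_apply σ).2 h'))]

/-- **Two matrices presented as conjugates of diagonals are conjugate iff the diagonals differ by a permutation** (`⇒`: equal characteristic polynomials, ★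
`exists_perm_of_charpoly_diagonal_eq`; `⇐`: permutation matrices). [cite: BrockerTomDieck1985, IV (2.5) (p0156)] [cite: Rogawski1990, §3.1 p. 19] -/
theorem isConj_iff_exists_perm_of_eq_conj_diagonal {A B S T : Matrix n n ℂ} {d d' : n → ℂ} (hS : IsUnit S.det) (hT : IsUnit T.det)
    (hA : A = S * Matrix.diagonal d * S⁻¹) (hB : B = T * Matrix.diagonal d' * T⁻¹) :
    IsConj A B ↔ ∃ σ : Equiv.Perm n, ∀ i, d' i = d (σ i) := by
  -- `A ∼ diag d`, `B ∼ diag d'`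
  have hAd : IsConj A (Matrix.diagonal d) := by
    refine ⟨(S.nonsingInvUnit hS)⁻¹, ?_⟩
    show S⁻¹ * A = Matrix.diagonal d * S⁻¹
    rw [hA]; simp only [Matrix.mul_assoc]; rw [Matrix.nonsing_inv_mul_cancel_left _ _ hS]
  have hBd : IsConj B (Matrix.diagonal d') := by
    refine ⟨(T.nonsingInvUnit hT)⁻¹, ?_⟩
    show T⁻¹ * B = Matrix.diagonal d' * T⁻¹
    rw [hB]; simp only [Matrix.mul_assoc]; rw [Matrix.nonsing_inv_mul_cancel_left _ _ hT]
  constructor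
  · intro h
    have hdd : IsConj (Matrix.diagonal d) (Matrix.diagonal d') := (hAd.symm.trans h).trans hBd
    obtain ⟨c, hc⟩ := hdd
    have hc' : (c : Matrix n n ℂ) * Matrix.diagonal d = Matrix.diagonal d' * c := hc
    have hchar : (Matrix.diagonal d).charpoly = (Matrix.diagonal d').charpoly := by
      have h1 : Matrix.diagonal d' = (c : Matrix n n ℂ) * Matrix.diagonal d * (c⁻¹ : (Matrix n n ℂ)ˣ) := by
        rw [hc', Units.mul_inv_cancel_right]
      rw [h1, Matrix.coe_units_inv, Matrix.charpoly_units_conj]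
    exact Literature.LinearAlgebra.Matrix.exists_perm_of_charpoly_diagonal_eq hchar
  · rintro ⟨σ, hσ⟩
    have hd' : Matrix.diagonal d' = Matrix.diagonal fun i => d (σ i) := by
      congr 1; funext i; exact hσ i
    rw [hd'] at hBd
    exact (hAd.trans (isConj_diagonal_perm d σ)).trans hBd.symm

variable (L : Type) [Field L] [NumberField L] [IsCMField L] {N : ℕ}

/-- **Conjugacy in `GL_N(L ⊗ ℝ)` (CM `L`) is checked place by place** (★ `GLnMixedPiEquiv`; the pattern of ★ (g1)∕(g2)). [cite: Rogawski1990, §14.2 p. 232] -/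
theorem isConj_iff_forall_place (g h : GL (Fin N) (mixedSpace L)) :
    IsConj g h ↔ ∀ w : {w : InfinitePlace L // IsComplex w},
      IsConj (Matrix.GeneralLinearGroup.map (evalC L w) g) (Matrix.GeneralLinearGroup.map (evalC L w) h) := by
  constructor
  · intro hc w
    exact (Matrix.GeneralLinearGroup.map (evalC L w)).map_isConj hc
  · intro hc
    choose u hu using fun w => isConj_iff.1 (hc w)
    set e := GLnMixedPiEquiv (↥(maximalRealSubfield L)) L (IsCMField.complexConj L) N (IsCMField.complexConj_ne_one L)
      (complexConj_smul_infinitePlace L) with he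
    refine isConj_iff.2 ⟨e.symm u, e.injective ?_⟩
    rw [map_mul, map_mul, map_inv, ContinuousMulEquiv.apply_symm_apply]
    funext w
    rw [Pi.mul_apply, Pi.mul_apply, Pi.inv_apply, he, GLnMixedPiEquiv_apply, GLnMixedPiEquiv_apply]
    exact hu w

end Generic

/-! ## §2 Place presentations: both chart points are explicit conjugates of diagonals -/

section Place

/-- Re-indexing an `∃ σ`-statement along a fixed permutation of the first index. [folklore] -/
private theorem exists_perm_comp_iff {X : Type*} (e : Equiv.Perm (Fin 3)) (g h : Fin 3 → X) :
    (∃ σ : Equiv.Perm (Fin 3), ∀ i, g (e i) = h (σ i)) ↔ ∃ σ : Equiv.Perm (Fin 3), ∀ i, g i = h (σ i) := by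
  constructor
  · rintro ⟨σ, hσ⟩
    refine ⟨e.symm.trans σ, fun i => ?_⟩
    rw [Equiv.trans_apply, ← hσ (e.symm i), Equiv.apply_symm_apply]
  · rintro ⟨σ, hσ⟩
    exact ⟨e.trans σ, fun i => by rw [Equiv.trans_apply, hσ (e i)]⟩

/-- **`ι(P·diag(z₀, z₂)·P⁻¹, u) = E · diag(z₀, u, z₂) · E⁻¹`**, `E = ι(P, 1)` — the embedded compact `2`-block is an explicit conjugate of a diagonal (★ `endoGL` is a
homomorphism, ★ `endoGL_circleDiagonal`). [cite: Rogawski1990, §4.8 p. 53; §8.2 p. 122] -/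
theorem coe_endoGL_cayley_eq_conj_diagonal (z₀ z₂ u : Circle) :
    ((endoGL (Matrix.GeneralLinearGroup.mkOfDetNeZero !![(1 : ℂ), 1; 1, -1] det_cayleyTwo_ne_zero * circleDiagonal 2 ![z₀, z₂] * (Matrix.GeneralLinearGroup.mkOfDetNeZero !![(1 : ℂ), 1; 1, -1] det_cayleyTwo_ne_zero)⁻¹, circleDiagonal 1 ![u]) : GL (Fin 3) ℂ) :
        Matrix (Fin 3) (Fin 3) ℂ) =
      ((endoGL (Matrix.GeneralLinearGroup.mkOfDetNeZero !![(1 : ℂ), 1; 1, -1] det_cayleyTwo_ne_zero, (1 : GL (Fin 1) ℂ)) : GL (Fin 3) ℂ) : Matrix (Fin 3) (Fin 3) ℂ) *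
        Matrix.diagonal ![(z₀ : ℂ), (u : ℂ), (z₂ : ℂ)] *
        (((endoGL (Matrix.GeneralLinearGroup.mkOfDetNeZero !![(1 : ℂ), 1; 1, -1] det_cayleyTwo_ne_zero, (1 : GL (Fin 1) ℂ)) : GL (Fin 3) ℂ) : Matrix (Fin 3) (Fin 3) ℂ))⁻¹ := by
  have hprod : ((Matrix.GeneralLinearGroup.mkOfDetNeZero !![(1 : ℂ), 1; 1, -1] det_cayleyTwo_ne_zero * circleDiagonal 2 ![z₀, z₂] * (Matrix.GeneralLinearGroup.mkOfDetNeZero !![(1 : ℂ), 1; 1, -1] det_cayleyTwo_ne_zero)⁻¹, circleDiagonal 1 ![u]) : GL (Fin 2) ℂ × GL (Fin 1) ℂ) =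
      (Matrix.GeneralLinearGroup.mkOfDetNeZero !![(1 : ℂ), 1; 1, -1] det_cayleyTwo_ne_zero, (1 : GL (Fin 1) ℂ)) * (circleDiagonal 2 ![z₀, z₂], circleDiagonal 1 ![u]) * (Matrix.GeneralLinearGroup.mkOfDetNeZero !![(1 : ℂ), 1; 1, -1] det_cayleyTwo_ne_zero, (1 : GL (Fin 1) ℂ))⁻¹ := by
    rw [Prod.inv_mk, inv_one, Prod.mk_mul_mk, Prod.mk_mul_mk, one_mul, mul_one]
  rw [hprod, map_mul, map_mul, map_inv, endoGL_circleDiagonal, Units.val_mul, Units.val_mul, Matrix.coe_units_inv, coe_circleDiagonal]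
  congr 3
  funext i
  fin_cases i <;> rfl

/-- **`ι(diag(e^{x+iθ}, e^{−x+iθ}), u) = diag(e^{x+iθ}, u, e^{−x+iθ})`** — the embedded split `2`-block is diagonal (★ `coe_endoGL_eq`). [cite: Rogawski1990, §4.8 p. 53] -/
theorem coe_endoGL_hypBlockGL_eq_diagonal (x θ : ℝ) (u : Circle) :
    ((endoGL (hypBlockGL x θ, circleDiagonal 1 ![u]) : GL (Fin 3) ℂ) : Matrix (Fin 3) (Fin 3) ℂ) =
      Matrix.diagonal ![Complex.exp ((x : ℂ) + (θ : ℂ) * I), (u : ℂ), Complex.exp (-(x : ℂ) + (θ : ℂ) * I)] := by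
  rw [coe_endoGL_eq, coe_hypBlockGL, coe_circleDiagonal]
  ext i j
  fin_cases i <;> fin_cases j <;> simp

variable (τ : Equiv.Perm (Fin 3)) (a : Fin 3 → ℝ)

/-- **The split place chart is an explicit conjugate of `diag(boostEig c ∘ τ⁻¹)`** by the re-indexed eigenvector matrix `cayB` (★ `boostStd_eq_conj_diagonal`).
[cite: Knapp1986, Ch. V §3] [cite: Rogawski1990, §3.6 p. 31] -/
theorem coe_gprimeSplitGL_eq_conj_diagonal (h : a (τ 0) * a (τ 2) < 0) (cw : Fin 3 → ℝ) :
    ((gprimeSplitGL τ a cw : GL (Fin 3) ℂ) : Matrix (Fin 3) (Fin 3) ℂ) =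
      (cayB (a ∘ τ)).submatrix τ.symm τ.symm * Matrix.diagonal (fun i => boostEig cw (τ.symm i)) * ((cayB (a ∘ τ)).submatrix τ.symm τ.symm)⁻¹ := by
  rw [coe_gprimeSplitGL, gprimeSplitMatrix, boostStd_eq_conj_diagonal (b := a ∘ τ) h cw,
    ← Matrix.submatrix_mul_equiv (cayB (a ∘ τ) * Matrix.diagonal (boostEig cw)) (cayB (a ∘ τ))⁻¹ τ.symm τ.symm τ.symm,
    ← Matrix.submatrix_mul_equiv (cayB (a ∘ τ)) (Matrix.diagonal (boostEig cw)) τ.symm τ.symm τ.symm,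
    Matrix.submatrix_diagonal_equiv, Matrix.inv_submatrix_equiv]
  rfl

/-- `det` of the re-indexed eigenvector matrix is a unit when the plane is hyperbolic. [cite: Knapp1986, Ch. V §3] -/
theorem isUnit_det_cayB_submatrix (h : a (τ 0) * a (τ 2) < 0) : IsUnit ((cayB (a ∘ τ)).submatrix τ.symm τ.symm).det := by
  rw [Matrix.det_submatrix_equiv_self]
  exact (det_cayB_ne_zero (b := a ∘ τ) h).isUnit

end Place

/-! ## §3 The norm-pair criterion between chart points and the partner family -/

section NormPairs

variable (L : Type) [Field L] [NumberField L] [IsCMField L] (α : Fin 3 → L)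
  (S S' : Finset {w : InfinitePlace L // IsComplex w}) (c c' : {w : InfinitePlace L // IsComplex w} → Fin 3 → ℝ)

/-- **NORM PAIRS BETWEEN THE ATLASES, PLACE BY PLACE**: `endoTorus S c ↔ gprimeTorus α S′ c′` (★ `IsArchNormPair`: `ι_∞(γ_H) ∼ γ′` in `GL₃(L ⊗ ℝ)`) iff at every
complex place the eigenvalue triple of the `G′` chart point is a permutation of that of the `H` chart point — `H`: `(e^{x+iθ}, e^{iφ}, e^{−x+iθ})` on `S`,
`(e^{ic₀}, e^{ic₁}, e^{ic₂})` off `S`; `G′`: `boostEig (c′ w)` on `S′ ⊆ splitChartPlaces`, `(e^{ic′_i})_i` off `S′`.  No regularity hypothesis.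
[cite: Rogawski1990, §4.3 p. 42; §14.3 p. 234; §3.1 p. 19] -/
theorem isArchNormPair_endoTorus_gprimeTorus_iff (hS' : ∀ w, w ∈ S' → w ∈ splitChartPlaces L α) :
    IsArchNormPair L (Matrix.diagonal α) (endoTorus L S c) (gprimeTorus L α S' c') ↔
      ∀ w : {w : InfinitePlace L // IsComplex w}, ∃ σ : Equiv.Perm (Fin 3), ∀ i : Fin 3,
        (if w ∈ S' then boostEig (c' w) else fun i => Complex.exp ((c' w i : ℂ) * I)) i =
          (if w ∈ S then ![Complex.exp ((c w 0 : ℂ) + (c w 2 : ℂ) * I), Complex.exp ((c w 1 : ℂ) * I), Complex.exp (-(c w 0 : ℂ) + (c w 2 : ℂ) * I)]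
            else fun i => Complex.exp ((c w i : ℂ) * I)) (σ i) := by
  rw [isArchNormPair_iff]
  unfold Corresponds
  rw [isConj_iff_forall_place]
  refine forall_congr' fun w => ?_
  -- the two place components
  have hH : Matrix.GeneralLinearGroup.map (evalC L w) ((endoEmbArch L (endoTorus L S c)).val : GL (Fin 3) (mixedSpace L)) =
      endoGL ((endoBlock L S c w : GL (Fin 2) ℂ), (endoCircle L c w : GL (Fin 1) ℂ)) := by
    rw [coe_endoEmbArch, map_endoGL, ← coe_archPiEquivCM_apply, ← coe_archPiEquivCM_apply, archPiEquivCM_endoTorus_fst, archPiEquivCM_endoTorus_snd]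
  have hG : Matrix.GeneralLinearGroup.map (evalC L w)
      ((gprimeTorus L α S' c' : arch (↥(maximalRealSubfield L)) L (IsCMField.complexConj L) 3 (Matrix.diagonal α)) : GL (Fin 3) (mixedSpace L)) =
      (gprimeBlock L α w S' c' : GL (Fin 3) ℂ) := by
    rw [← coe_archPiEquivCM_apply, archPiEquivCM_gprimeTorus]
  set τ : Equiv.Perm (Fin 3) := lineOf (formSign L α w) with hτ
  -- `G′` side: `Y = T · diag(gY ∘ τ⁻¹) · T⁻¹`
  have hY : ∃ T : Matrix (Fin 3) (Fin 3) ℂ, IsUnit T.det ∧ ((gprimeBlock L α w S' c' : GL (Fin 3) ℂ) : Matrix (Fin 3) (Fin 3) ℂ) =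
      T * Matrix.diagonal (fun i => (if w ∈ S' then boostEig (c' w) else fun i => Complex.exp ((c' w i : ℂ) * I)) (τ.symm i)) * T⁻¹ := by
    by_cases hw' : w ∈ S'
    · refine ⟨(cayB (formRe L α w ∘ τ)).submatrix τ.symm τ.symm, isUnit_det_cayB_submatrix τ _ (hS' w hw').2, ?_⟩
      rw [if_pos hw', coe_gprimeBlock_of_mem L α c' hw' (hS' w hw')]
      exact coe_gprimeSplitGL_eq_conj_diagonal τ _ (hS' w hw').2 (c' w)
    · refine ⟨1, by rw [Matrix.det_one]; exact isUnit_one, ?_⟩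
      rw [if_neg hw', coe_gprimeBlock_of_not_mem L α c' hw', coe_gprimeCptGL, inv_one, Matrix.one_mul, Matrix.mul_one]
  -- `H` side: `X = R · diag(hX) · R⁻¹`
  have hX : ∃ R : Matrix (Fin 3) (Fin 3) ℂ, IsUnit R.det ∧ ((endoGL ((endoBlock L S c w : GL (Fin 2) ℂ), (endoCircle L c w : GL (Fin 1) ℂ)) : GL (Fin 3) ℂ) :
      Matrix (Fin 3) (Fin 3) ℂ) = R * Matrix.diagonal (if w ∈ S then
        ![Complex.exp ((c w 0 : ℂ) + (c w 2 : ℂ) * I), Complex.exp ((c w 1 : ℂ) * I), Complex.exp (-(c w 0 : ℂ) + (c w 2 : ℂ) * I)]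
        else fun i => Complex.exp ((c w i : ℂ) * I)) * R⁻¹ := by
    by_cases hw : w ∈ S
    · refine ⟨1, by rw [Matrix.det_one]; exact isUnit_one, ?_⟩
      rw [if_pos hw, coe_endoBlock_eq_hypBlockGL_of_mem L S c hw, coe_endoCircle_eq, coe_endoGL_hypBlockGL_eq_diagonal, Circle.coe_exp,
        inv_one, Matrix.one_mul, Matrix.mul_one]
    · refine ⟨((endoGL (Matrix.GeneralLinearGroup.mkOfDetNeZero !![(1 : ℂ), 1; 1, -1] det_cayleyTwo_ne_zero, (1 : GL (Fin 1) ℂ)) : GL (Fin 3) ℂ) : Matrix (Fin 3) (Fin 3) ℂ),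
        (Matrix.isUnit_iff_isUnit_det _).1 (Units.isUnit _), ?_⟩
      rw [if_neg hw, coe_endoBlock_eq_cayley_of_not_mem L S c hw, coe_endoCircle_eq, coe_endoGL_cayley_eq_conj_diagonal, Circle.coe_exp, Circle.coe_exp,
        Circle.coe_exp]
      congr 2
      funext i
      fin_cases i <;> rfl
  obtain ⟨T, hT, hYT⟩ := hY
  obtain ⟨R, hR, hXR⟩ := hX
  rw [hH, hG, isConj_units_iff_coe, isConj_iff_exists_perm_of_eq_conj_diagonal hR hT hXR hYT]
  exact exists_perm_comp_iff τ.symm _ _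

/-- **THE PARTNER FAMILY**: for the SAME chart set `S ⊆ splitChartPlaces` and slot permutations `ρ_w` with `ρ_w = 1` at the split places, the `G′` chart point with
coordinates `c_w ∘ ρ_w` is a norm partner of `endoTorus S c` — at a split place `boostEig (x, φ, θ) = (e^{x+iθ}, e^{iφ}, e^{−x+iθ})` is the `H` triple on the nose, at a
compact place the triple is permuted by `ρ_w`. [cite: Rogawski1990, §4.3 p. 42; §14.3 p. 234] -/
theorem isArchNormPair_endoTorus_gprimeTorus_perm (hS : ∀ w, w ∈ S → w ∈ splitChartPlaces L α)
    (ρ : {w : InfinitePlace L // IsComplex w} → Equiv.Perm (Fin 3)) (hρ : ∀ w, w ∈ S → ρ w = 1) :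
    IsArchNormPair L (Matrix.diagonal α) (endoTorus L S c) (gprimeTorus L α S fun w => c w ∘ ρ w) := by
  rw [isArchNormPair_endoTorus_gprimeTorus_iff L α S S c _ hS]
  intro w
  by_cases hw : w ∈ S
  · refine ⟨1, fun i => ?_⟩
    rw [if_pos hw, if_pos hw, hρ w hw]
    fin_cases i <;> simp [boostEig]
  · refine ⟨ρ w, fun i => ?_⟩
    rw [if_neg hw, if_neg hw]
    rfl

/-- In particular the chart point itself (`ρ = 1`): **`endoTorus S c ↔ gprimeTorus α S c`** for `S ⊆ splitChartPlaces`. [cite: Rogawski1990, §4.3 p. 42] -/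
theorem isArchNormPair_endoTorus_gprimeTorus (hS : ∀ w, w ∈ S → w ∈ splitChartPlaces L α) :
    IsArchNormPair L (Matrix.diagonal α) (endoTorus L S c) (gprimeTorus L α S c) := by
  have h := isArchNormPair_endoTorus_gprimeTorus_perm L α S c hS (fun _ => 1) (fun _ _ => rfl)
  exact h

end NormPairs

end Literature.NumberTheory.Automorphic.UnitaryGroup

end
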